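import Literature.NumberTheory.Transcendental.RoySmallValueStep2Core
import Literature.NumberTheory.Transcendental.RoySmallValueOrbitSelection
import Literature.NumberTheory.Transcendental.RoySmallValueGainPhi
import Literature.NumberTheory.Transcendental.RoySmallValuePhiLength
import Literature.NumberTheory.Transcendental.RoySmallValueLinearFactorsFintype
import Literature.NumberTheory.Transcendental.RoySmallValueSelectionLemma
import Literature.NumberTheory.Transcendental.RoySmallValueLiouville
import HarnessLib

/-!
# Roy's small value estimate for `𝔾ₐ × 𝔾ₘ` — Step 2, selection of an orbit (Proposition 6.2 for `Φ`)

Topic `Literature/NumberTheory/Transcendental`. Part of the formalisation of the proof of Roy 2013,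
Theorem 1.1 (named fact `roy2013_thm_1_1`, `RoySmallValueEstimates.lean`). Source: D. Roy,
*A small value estimate for `𝔾ₐ × 𝔾ₘ`*, Mathematika 59 (2013) 333–363 = arXiv:1301.0663, §6,
Proposition 6.2 and §7, Step 2 (pp. 16, 18 of the arXiv text):

> **Proposition 6.2.** [...] Then, there exists a subvariety `Z` of `𝒵(𝒟ⁱP ; 0 ≤ i < 2T)` of
> dimension `0` with `h_𝒞(Z) ≤ −C''(Y deg(Z) + D h(Z))` [...]
> [Step 2] `∑_{α ∈ Z} log sup{|P(α)| ; P ∈ 𝒞_D} ≤ h_{𝒞_D}(Z) − D h(Z) + 9 log(3) D deg(Z)`.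

We realise `Z` as an orbit `O` of the normalised representatives `α_j` of `𝒵(P, Q)` under
`Aut(K/ℚ)` (`ZeroConfigK`) and prove (`step2_select`): given the factorisation
`Φ(P, Q, ·) = c ∏ ℓ_{α_j}^{e_j}` and a convex body `𝒞` of forms of degree `D` with
`sup_𝒞 |Φ(P, Q, ·)| ≤ B`, `2^{2k2^k} B < 1`, there is an orbit `O` such that for EVERY family
`(R_j)_{j ∈ O}` of elements of `𝒞`,

  `∏_{j ∈ O} ( |R_j(α_j)| / ‖α_j‖^D · e^{D h_j} ) ≤ (2^{2k2^k} B)^{w_O / B_w}`,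

`h_j = h_K(a_j)/[K:ℚ]`, `w_O = ∑_{j∈O} (Y + D h_j)`, `B_w = ∑_j e_j (Y + D h_j)` — the test-family
form of `h_𝒞(Z) ≤ −C''(Y deg Z + D h(Z))` combined with the display of Step 2. Ingredients: the
product inequality (`step2_core`), the height gain (`gain`), and the selection lemma of the tree
(`exists_component_forall_prod_le`, seat B) applied to the orbits with the constant exponents
`e_j` (`mult_perm`). We also prove the consequence used in Step 3 (`step2_vanish`): an INTEGER form
in `𝒞` vanishes on `O` (Liouville's inequality summed over the orbit, `neg_logHeight_le_sum_log`
of the tree + `sum_orb_sum_emb`), and the Gelfond–Mahler bound `D ∑ e_j h_j ≤ log 𝓛(F)` for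
`B_w` (`sum_mul_height_le_log_l1Norm`). Everything is proved; the definitions (`orep`, `hgtK`)
are bookkeeping; no named facts.

## References

* [Roy2013] D. Roy, *A small value estimate for 𝔾ₐ × 𝔾ₘ*, Mathematika 59 (2013), 333–363
  (arXiv:1301.0663), Proposition 6.2, Proposition 2.4 and §7, Step 2.
-/

noncomputable section

open MvPolynomial Finset NumberField Height

namespace Literature.NumberTheory.Transcendental

namespace Roy2013

open Nesterenko

/-! ### Orbit representatives -/

namespace ZeroConfigK

variable {K : IntermediateField ℚ ℂ} [Normal ℚ K] [NumberField K] {m : ℕ} (Z : ZeroConfigK K (Fin m))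

-- `orb_eq_of_mem` (orbits are equal or disjoint) is the tree's (`RoySmallValueOrbitSelection`, seat B).

omit [Normal ℚ K] in
/-- The chosen representative of the orbit of `j` (its least element). [folklore] -/
def orep (j : Fin m) : Fin m := (Z.orb j).min' ⟨j, Z.self_mem_orb j⟩

omit [Normal ℚ K] in
/-- The representative lies in the orbit. [folklore] -/
theorem orep_mem (j : Fin m) : Z.orep j ∈ Z.orb j := Finset.min'_mem _ _

omit [Normal ℚ K] in
/-- Points of one orbit have the same representative. [folklore] -/
theorem orep_eq_of_mem {j j' : Fin m} (h : j' ∈ Z.orb j) : Z.orep j' = Z.orep j := by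
  simp only [orep, Z.orb_eq_of_mem h]

omit [Normal ℚ K] in
/-- The orbit of the representative. [folklore] -/
theorem orb_orep (j : Fin m) : Z.orb (Z.orep j) = Z.orb j := Z.orb_eq_of_mem (Z.orep_mem j)

omit [Normal ℚ K] in
/-- `orep` is idempotent. [folklore] -/
theorem orep_orep (j : Fin m) : Z.orep (Z.orep j) = Z.orep j := Z.orep_eq_of_mem (Z.orep_mem j)

omit [Normal ℚ K] in
/-- The fibre of `orep` over a representative is its orbit. [folklore] -/
theorem orep_eq_iff {i j : Fin m} (hi : Z.orep i = i) : Z.orep j = i ↔ j ∈ Z.orb i := by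
  constructor
  · intro h
    have h1 : Z.orep j ∈ Z.orb j := Z.orep_mem j
    rw [h] at h1
    -- `i ∈ O_j`, so `O_i = O_j ∋ j`
    rw [Z.orb_eq_of_mem h1]
    exact Z.self_mem_orb j
  · intro h
    rw [Z.orep_eq_of_mem h, hi]

end ZeroConfigK

/-! ### The normalised heights `h_j` -/

variable {K : IntermediateField ℚ ℂ} [Normal ℚ K] [NumberField K] {m : ℕ} (Z : ZeroConfigK K (Fin m))

omit [Normal ℚ K] in
/-- `h_j = h_K(a_j) / [K:ℚ]` (the absolute logarithmic height of the point `α_j`).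
[cite: Roy2013, §2 ("`h(Z)`")] -/
def hgtK (j : Fin m) : ℝ := logHeight (Z.rep j) / Module.finrank ℚ K

omit [Normal ℚ K] in
/-- `h_j ≥ 0`. [folklore] -/
theorem hgtK_nonneg (j : Fin m) : 0 ≤ hgtK Z j :=
  div_nonneg (logHeight_nonneg _) (Nat.cast_nonneg _)

omit [Normal ℚ K] in
/-- `[K:ℚ] > 0`. [folklore] -/
theorem finrank_pos_real : (0 : ℝ) < Module.finrank ℚ K := by
  exact_mod_cast Module.finrank_pos

variable {D : ℕ} {M₁ M₂ : Finset (Fin 3 →₀ ℕ)}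

omit [Normal ℚ K] in
/-- **Gelfond–Mahler for `Φ`**: `D ∑_j e_j h_j ≤ log 𝓛(F)` for `F = Φ(P, Q, ·) = c ∏ ℓ_{α_j}^{e_j}`
with integer `P, Q`. [cite: Roy2013, Proposition 6.4 (proof, height half) — via `sum_mul_logHeight_le'`] -/
theorem sum_mul_hgtK_le_log_l1Norm (σ : PhiCol D M₁ M₂ ≃ PhiRow D) {P Q : CX}
    {F₀ : MvPolynomial (CoefIdx D) ℤ} (hF₀ : map (Int.castRingHom ℂ) F₀ = royF D M₁ M₂ σ P Q)
    {c : ℂ} (hc : c ≠ 0) {e : Fin m → ℕ}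
    (hFeq : royF D M₁ M₂ σ P Q = C c * ∏ i, evalForm D (Z.α i) ^ e i) :
    (D : ℝ) * ∑ j, (e j : ℝ) * hgtK Z j ≤ Real.log (l1Norm (royF D M₁ M₂ σ P Q)) := by
  classical
  have hfac : map (Int.castRingHom ℂ) F₀ = C c * ∏ i, evalForm D (Z.α i) ^ e i := by
    rw [hF₀, hFeq]
  have hF₀0 : F₀ ≠ 0 := by
    intro h
    have h1 : royF D M₁ M₂ σ P Q = 0 := by rw [← hF₀, h, map_zero]
    rw [hFeq] at h1
    exact (mul_ne_zero (C_ne_zero.mpr hc) (prod_ne_zero_iff.mpr fun i _ =>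
      pow_ne_zero _ (evalForm_ne_zero (Z.α_ne_zero i)))) h1
  obtain ⟨A, -, hK⟩ := exists_factorisation_fld Z hfac
  set cv : Fin m → CoefIdx D → K := fun j ν => ∏ k, Z.rep j k ^ (ν.1 k) with hcv
  have hK' : map (Int.castRingHom K) F₀ = C A * ∏ j, (∑ ν, C (cv j ν) * X ν) ^ e j := by
    rw [hK]; rfl
  have hcv0 : ∀ j, cv j ≠ 0 := fun j => veronese_rep_ne_zero Z j
  haveI : Nonempty (CoefIdx D) := ⟨⟨Finsupp.single 0 D, by
    rw [mem_finsuppAntidiag]; exact ⟨by simp, subset_univ _⟩⟩⟩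
  have h := sum_mul_logHeight_le' hF₀0 hcv0 hK'
  have hL : ∑ j, (e j : ℝ) * logHeight (cv j) =
      Module.finrank ℚ K * ((D : ℝ) * ∑ j, (e j : ℝ) * hgtK Z j) := by
    rw [Finset.mul_sum, Finset.mul_sum]
    have hn : (Module.finrank ℚ K : ℝ) ≠ 0 := finrank_pos_real.ne'
    refine Finset.sum_congr rfl fun j _ => ?_
    rw [hcv, logHeight_veronese (Z.rep j) (Z.rep_ne_zero j), hgtK]
    field_simp
  have hR : Real.log (∑ mo ∈ F₀.support, |((coeff mo F₀ : ℤ) : ℝ)|) =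
      Real.log (l1Norm (royF D M₁ M₂ σ P Q)) := by
    rw [← l1Norm_map_intCast, hF₀]
  rw [hL, hR] at h
  exact le_of_mul_le_mul_left h finrank_pos_real

/-! ### The selection -/

/-- **Roy 2013, Proposition 6.2 / Step 2, for `Φ` and orbits.** See the module docstring.
[cite: Roy2013, Proposition 6.2 and §7, Step 2] -/
theorem step2_select (hM₁ : ∀ μ ∈ M₁, μ.degree = 2 * D) (hM₂ : ∀ μ ∈ M₂, μ.degree = 2 * D)
    (σ : PhiCol D M₁ M₂ ≃ PhiRow D) {P Q : CX}
    {F₀ : MvPolynomial (CoefIdx D) ℤ} (hF₀ : map (Int.castRingHom ℂ) F₀ = royF D M₁ M₂ σ P Q)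
    {c : ℂ} (hc : c ≠ 0) {e : Fin m → ℕ} (he1 : ∀ i, 1 ≤ e i)
    (hFeq : royF D M₁ M₂ σ P Q = C c * ∏ i, evalForm D (Z.α i) ^ e i)
    (hemax : ∀ i k, evalForm D (Z.α i) ^ k ∣ royF D M₁ M₂ σ P Q → k ≤ e i)
    {𝒞 : Set CX} (hconv : ∀ R ∈ 𝒞, ∀ S ∈ 𝒞, ∀ a b : ℂ, ‖a‖ + ‖b‖ ≤ 1 → a • R + b • S ∈ 𝒞)
    (hne : 𝒞.Nonempty) (hhom : ∀ R ∈ 𝒞, R.IsHomogeneous D)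
    {B : ℝ} (hB : ∀ R ∈ 𝒞, ‖royPhi D M₁ M₂ σ ![P, Q, R]‖ ≤ B)
    (k : ℕ) (hk : ∑ i, e i ≤ 2 ^ k) (hε0 : 0 < (2 : ℝ) ^ (2 * k * 2 ^ k) * B)
    (hε1 : (2 : ℝ) ^ (2 * k * 2 ^ k) * B < 1)
    {Y : ℝ} (hY : 0 < Y) (hm : 0 < m) :
    ∃ i₀ : Fin m, ∀ t : Fin m → CX, (∀ j ∈ Z.orb i₀, t j ∈ 𝒞) →
      ∏ j ∈ Z.orb i₀, (‖eval (Z.α j) (t j)‖ / ‖Z.α j‖ ^ D * Real.exp (D * hgtK Z j)) ≤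
        ((2 : ℝ) ^ (2 * k * 2 ^ k) * B) ^
          ((∑ j ∈ Z.orb i₀, (Y + D * hgtK Z j)) / ∑ j, (e j : ℝ) * (Y + D * hgtK Z j)) := by
  classical
  -- components = orbits, indexed by their representatives
  let I := {i : Fin m // Z.orep i = i}
  let comp : Fin m → I := fun j => ⟨Z.orep j, Z.orep_orep j⟩
  let e' : I → ℕ := fun i => e i.1
  let w : I → ℝ := fun i => ∑ j ∈ Z.orb i.1, (Y + D * hgtK Z j)
  let v : Fin m → CX → ℝ := fun j R => ‖eval (Z.α j) R‖ / ‖Z.α j‖ ^ D * Real.exp (D * hgtK Z j)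
  set ε : ℝ := (2 : ℝ) ^ (2 * k * 2 ^ k) * B with hε
  set Bw : ℝ := ∑ j, (e j : ℝ) * (Y + D * hgtK Z j) with hBw
  -- `e` is constant on orbits
  have hecomp : ∀ j, e' (comp j) = e j := fun j => by
    change e (Z.orep j) = e j
    obtain ⟨-, g, hg⟩ := mem_filter.mp (Z.orep_mem j)
    rw [← hg, mult_perm Z (by rw [hF₀, hFeq]) (fun i k hk => hemax i k (by rwa [← hF₀])) g j]
  -- fibres of `comp` are orbits
  have hfib : ∀ i : I, univ.filter (fun j => comp j = i) = Z.orb i.1 := fun i => by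
    ext j
    simp only [mem_filter, mem_univ, true_and]
    rw [Subtype.ext_iff]
    exact Z.orep_eq_iff i.2
  -- the weights sum to `Bw`
  have hBwpos : 0 < Bw := by
    haveI : Nonempty (Fin m) := ⟨⟨0, hm⟩⟩
    rw [hBw]
    refine Finset.sum_pos (fun j _ => mul_pos (by exact_mod_cast he1 j) ?_) univ_nonempty
    have := hgtK_nonneg Z j
    positivity
  have hsum : ∑ i : I, (e' i : ℝ) * w i ≤ Bw := by
    refine le_of_eq ?_
    rw [hBw]
    -- `∑_j f j = ∑_{i} ∑_{j ∈ fibre i} f j`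
    rw [← Finset.sum_fiberwise univ comp (fun j => (e j : ℝ) * (Y + D * hgtK Z j))]
    refine Finset.sum_congr rfl fun i _ => ?_
    rw [hfib, Finset.mul_sum]
    refine Finset.sum_congr rfl fun j hj => ?_
    have h1 : e' i = e j := by
      rw [← hecomp j]
      congr 1
      exact Subtype.ext ((Z.orep_eq_iff i.2).mpr hj).symm
    rw [h1]
  -- the product inequality + the gain
  have H : ∀ t : Fin m → CX, (∀ j, t j ∈ 𝒞) → ∏ j, v j (t j) ^ e' (comp j) ≤ ε := by
    intro t ht
    simp_rw [hecomp]
    have h1 := step2_core hM₁ hM₂ σ hc hFeq hconv hne hhom hB k hk t ht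
    have hg := gain Z (F₀ := F₀) (by
      intro h
      have h2 : royF D M₁ M₂ σ P Q = 0 := by rw [← hF₀, h, map_zero]
      rw [hFeq] at h2
      exact (mul_ne_zero (C_ne_zero.mpr hc) (prod_ne_zero_iff.mpr fun i _ =>
        pow_ne_zero _ (evalForm_ne_zero (Z.α_ne_zero i)))) h2) (by rw [hF₀, hFeq])
      (fun i k hk => hemax i k (by rwa [← hF₀]))
    -- `exp(D ∑ e_j h_j) ≤ |c| ∏ ‖α_j‖^{D e_j}`
    have hpos : ∀ j, 0 < ‖Z.α j‖ := fun j => lt_of_lt_of_le one_pos (one_le_norm_α Z j)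
    have hgain : Real.exp (D * ∑ j, (e j : ℝ) * hgtK Z j) ≤ ‖c‖ * ∏ j, ‖Z.α j‖ ^ (D * e j) := by
      have h3 : (D : ℝ) * ∑ j, (e j : ℝ) * hgtK Z j ≤
          Real.log ‖c‖ + D * ∑ j, (e j : ℝ) * Real.log ‖Z.α j‖ := by
        have h4 : (D : ℝ) * ∑ j, (e j : ℝ) * hgtK Z j =
            ((D : ℝ) * ∑ j, (e j : ℝ) * logHeight (Z.rep j)) / Module.finrank ℚ K := by
          simp only [hgtK, Finset.mul_sum]
          rw [Finset.sum_div]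
          refine Finset.sum_congr rfl fun j _ => ?_
          ring
        rw [h4, div_le_iff₀ finrank_pos_real, mul_comm _ (Module.finrank ℚ K : ℝ)]
        exact hg
      calc Real.exp (D * ∑ j, (e j : ℝ) * hgtK Z j)
          ≤ Real.exp (Real.log ‖c‖ + D * ∑ j, (e j : ℝ) * Real.log ‖Z.α j‖) :=
            Real.exp_le_exp.mpr h3
        _ = ‖c‖ * ∏ j, ‖Z.α j‖ ^ (D * e j) := by
            rw [Real.exp_add, Real.exp_log (norm_pos_iff.mpr hc), Finset.mul_sum, Real.exp_sum]
            congr 1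
            refine Finset.prod_congr rfl fun j _ => ?_
            rw [← mul_assoc, show (D : ℝ) * (e j : ℝ) = ((D * e j : ℕ) : ℝ) by push_cast; ring,
              ← Real.log_pow, Real.exp_log (pow_pos (hpos j) _)]
    -- rewrite the product of the `v`'s
    have hv1 : ∀ j, v j (t j) ^ e j = ‖eval (Z.α j) (t j)‖ ^ e j * ((‖Z.α j‖ ^ (D * e j))⁻¹ *
        Real.exp ((e j : ℝ) * (D * hgtK Z j))) := fun j => by
      simp only [v]
      rw [mul_pow, div_pow, ← pow_mul, ← Real.exp_nat_mul, div_eq_mul_inv, mul_assoc]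
    have hv : ∏ j, v j (t j) ^ e j = (∏ j, ‖eval (Z.α j) (t j)‖ ^ e j) *
        ((∏ j, ‖Z.α j‖ ^ (D * e j))⁻¹ * Real.exp (D * ∑ j, (e j : ℝ) * hgtK Z j)) := by
      have hs : ∑ j, (e j : ℝ) * (D * hgtK Z j) = D * ∑ j, (e j : ℝ) * hgtK Z j := by
        rw [Finset.mul_sum]; exact Finset.sum_congr rfl fun j _ => by ring
      rw [Finset.prod_congr rfl (fun j _ => hv1 j), prod_mul_distrib, prod_mul_distrib,
        prod_inv_distrib, ← Real.exp_sum, hs]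
    rw [hv]
    have hprodpos : 0 < ∏ j, ‖Z.α j‖ ^ (D * e j) := prod_pos fun j _ => pow_pos (hpos j) _
    have hApos : 0 ≤ ∏ j, ‖eval (Z.α j) (t j)‖ ^ e j :=
      prod_nonneg fun j _ => pow_nonneg (norm_nonneg _) _
    calc (∏ j, ‖eval (Z.α j) (t j)‖ ^ e j) *
          ((∏ j, ‖Z.α j‖ ^ (D * e j))⁻¹ * Real.exp (D * ∑ j, (e j : ℝ) * hgtK Z j))
        ≤ (∏ j, ‖eval (Z.α j) (t j)‖ ^ e j) *
            ((∏ j, ‖Z.α j‖ ^ (D * e j))⁻¹ * (‖c‖ * ∏ j, ‖Z.α j‖ ^ (D * e j))) :=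
          mul_le_mul_of_nonneg_left (mul_le_mul_of_nonneg_left hgain
            (inv_nonneg.mpr hprodpos.le)) hApos
      _ = ‖c‖ * ∏ j, ‖eval (Z.α j) (t j)‖ ^ e j := by
          rw [mul_comm ‖c‖ (∏ j, ‖Z.α j‖ ^ (D * e j)), inv_mul_cancel_left₀ hprodpos.ne',
            mul_comm]
      _ ≤ ε := h1
  -- the selection lemma
  obtain ⟨i, hi⟩ := exists_component_forall_prod_le comp e' (fun i => he1 i.1) w (· ∈ 𝒞) v hε0
    hε1 hBwpos hsum H
  refine ⟨i.1, fun t ht => ?_⟩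
  have h := hi t (fun j hj => ht j ((Z.orep_eq_iff i.2).mp (congrArg Subtype.val hj)))
  rw [hfib] at h
  exact h

/-! ### Liouville's inequality on an orbit, and vanishing of integer forms -/

omit [Normal ℚ K] [NumberField K] in
/-- Values of an integer form at conjugates: `σ(P(a_j)) = P(σ ∘ a_j)`. [folklore] -/
theorem emb_aeval_repK_int (σ' : K →+* ℂ) (Pz : MvPolynomial (Fin 3) ℤ) (j : Fin m) :
    σ' (aeval (Z.rep j) Pz) = eval (σ' ∘ Z.rep j) (map (Int.castRingHom ℂ) Pz) := by
  rw [map_aeval, eval_map, RingHom.ext_int (σ'.comp (algebraMap ℤ K)) (Int.castRingHom ℂ),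
    coe_eval₂Hom]
  rfl

omit [Normal ℚ K] [NumberField K] in
/-- Values of an integer form at the point `α_j`, from `K`. [folklore] -/
theorem coe_aeval_repK_int (Pz : MvPolynomial (Fin 3) ℤ) (j : Fin m) :
    ((aeval (Z.rep j) Pz : K) : ℂ) = eval (Z.α j) (map (Int.castRingHom ℂ) Pz) := by
  change algebraMap K ℂ (aeval (Z.rep j) Pz) = _
  rw [map_aeval, eval_map, coe_eval₂Hom, RingHom.ext_int ((algebraMap K ℂ).comp (algebraMap ℤ K))
    (Int.castRingHom ℂ)]
  rfl

omit [Normal ℚ K] [NumberField K] in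
/-- An integer form vanishing at `α_j` vanishes on the whole orbit of `j`. [folklore] -/
theorem eval_perm_eq_zero_of_eval_eq_zero (Pz : MvPolynomial (Fin 3) ℤ) {j : Fin m}
    (h : eval (Z.α j) (map (Int.castRingHom ℂ) Pz) = 0) (g : K ≃ₐ[ℚ] K) :
    eval (Z.α (Z.perm g j)) (map (Int.castRingHom ℂ) Pz) = 0 := by
  have h1 : aeval (Z.rep j) Pz = 0 := by
    apply Subtype.ext
    rw [coe_aeval_repK_int, h]; rfl
  have h2 : aeval (Z.rep (Z.perm g j)) Pz = 0 := by
    rw [← Z.rep_perm g j]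
    have h3 : (g : K →+* K) (aeval (Z.rep j) Pz) = aeval (fun k => g (Z.rep j k)) Pz := by
      rw [map_aeval, RingHom.ext_int ((g : K →+* K).comp (algebraMap ℤ K)) (algebraMap ℤ K),
        coe_eval₂Hom, ← aeval_def]
      rfl
    rw [← h3, h1, map_zero]
  rw [← coe_aeval_repK_int, h2]; rfl

/-- **Liouville's inequality on an orbit**: for an integer form `P` of degree `D` non-vanishing on
the orbit `O`, `−D ∑_{j∈O} h_j ≤ ∑_{j∈O} log(|P(α_j)| / ‖α_j‖^D)`.
[cite: Roy2013, Proposition 2.3, (2.2) (`h_𝒞(Z) ≥ −D h(Z) − …` for `ℤ[X]_D ∩ 𝒞 ⊄ I_Z`), here via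
the tree's `neg_logHeight_le_sum_log` summed over the orbit] -/
theorem orbit_liouville_K {Pz : MvPolynomial (Fin 3) ℤ} {D : ℕ} (hP : Pz.IsHomogeneous D)
    (i₀ : Fin m) (hne : ∀ j ∈ Z.orb i₀, eval (Z.α j) (map (Int.castRingHom ℂ) Pz) ≠ 0) :
    -((D : ℝ) * ∑ j ∈ Z.orb i₀, hgtK Z j) ≤
      ∑ j ∈ Z.orb i₀, Real.log (‖eval (Z.α j) (map (Int.castRingHom ℂ) Pz)‖ / ‖Z.α j‖ ^ D) := by
  classical
  set F : (Fin 3 → ℂ) → ℝ := fun β => Real.log (‖eval β (map (Int.castRingHom ℂ) Pz)‖ / ‖β‖ ^ D)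
    with hF
  -- per point
  have hpt : ∀ j ∈ Z.orb i₀, -((D : ℝ) * logHeight (Z.rep j)) ≤ ∑ σ' : K →+* ℂ, F (σ' ∘ Z.rep j) := by
    intro j hj
    have ha : aeval (Z.rep j) Pz ≠ 0 := fun h0 => hne j hj (by
      rw [← coe_aeval_repK_int, h0]; rfl)
    have h := neg_logHeight_le_sum_log hP (Z.rep_ne_zero j) ha
    refine h.trans (le_of_eq (Finset.sum_congr rfl fun σ' _ => ?_))
    rw [hF]
    change _ = Real.log (‖eval (σ' ∘ Z.rep j) (map (Int.castRingHom ℂ) Pz)‖ / ‖σ' ∘ Z.rep j‖ ^ D)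
    have key : ∀ f : ℤ →+* ℂ, eval₂ f (fun i => σ' (Z.rep j i)) Pz =
        eval₂ (Int.castRingHom ℂ) (σ' ∘ Z.rep j) Pz := fun f => by
      rw [RingHom.ext_int f (Int.castRingHom ℂ)]; rfl
    rw [map_aeval, eval_map, coe_eval₂Hom, key]
  -- sum over the orbit
  have hsum := Finset.sum_le_sum hpt
  rw [Z.sum_orb_sum_emb i₀ F, ZeroConfigK.card_aut_eq_finrank K] at hsum
  have hn := finrank_pos_real (K := K)
  have hL : ∑ j ∈ Z.orb i₀, -((D : ℝ) * logHeight (Z.rep j)) =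
      Module.finrank ℚ K * -((D : ℝ) * ∑ j ∈ Z.orb i₀, hgtK Z j) := by
    rw [mul_neg, Finset.mul_sum, Finset.mul_sum, ← Finset.sum_neg_distrib]
    refine Finset.sum_congr rfl fun j _ => ?_
    rw [hgtK]
    field_simp
  rw [hL, nsmul_eq_mul] at hsum
  exact le_of_mul_le_mul_left hsum hn

/-- **Step 2 ⇒ vanishing of integer forms on the selected orbit.** If the orbit `O` satisfies the
conclusion of `step2_select` with a bound `< 1` for the constant family `R_j = P`, `P` an integer
form of degree `D` in `𝒞`, then `P` vanishes at every point of `O`.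
[cite: Roy2013, Proposition 6.2 (conclusion "`Z ⊆ 𝒵(𝒟ⁱP ; 0 ≤ i < 2T)`") and §7, Step 2] -/
theorem step2_vanish {Pz : MvPolynomial (Fin 3) ℤ} {D : ℕ} (hP : Pz.IsHomogeneous D) (i₀ : Fin m)
    {θ : ℝ} (hθ : θ < 1)
    (h : ∏ j ∈ Z.orb i₀, (‖eval (Z.α j) (map (Int.castRingHom ℂ) Pz)‖ / ‖Z.α j‖ ^ D *
      Real.exp (D * hgtK Z j)) ≤ θ) :
    ∀ j ∈ Z.orb i₀, eval (Z.α j) (map (Int.castRingHom ℂ) Pz) = 0 := by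
  classical
  -- some point of the orbit is a zero
  have hex : ∃ j ∈ Z.orb i₀, eval (Z.α j) (map (Int.castRingHom ℂ) Pz) = 0 := by
    by_contra hcon
    push Not at hcon
    have hL := orbit_liouville_K Z hP i₀ hcon
    have hpos : ∀ j ∈ Z.orb i₀, 0 < ‖eval (Z.α j) (map (Int.castRingHom ℂ) Pz)‖ / ‖Z.α j‖ ^ D :=
      fun j hj => div_pos (norm_pos_iff.mpr (hcon j hj))
        (pow_pos (lt_of_lt_of_le one_pos (one_le_norm_α Z j)) _)
    -- the product is `≥ 1`
    have h1 : (1 : ℝ) ≤ ∏ j ∈ Z.orb i₀, (‖eval (Z.α j) (map (Int.castRingHom ℂ) Pz)‖ / ‖Z.α j‖ ^ D *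
        Real.exp (D * hgtK Z j)) := by
      rw [← Real.exp_zero,
        ← Real.exp_log (prod_pos fun j hj => mul_pos (hpos j hj) (Real.exp_pos _))]
      refine Real.exp_le_exp.mpr ?_
      rw [Real.log_prod (fun j hj => (mul_pos (hpos j hj) (Real.exp_pos _)).ne')]
      have h2 : ∑ j ∈ Z.orb i₀, Real.log (‖eval (Z.α j) (map (Int.castRingHom ℂ) Pz)‖ /
          ‖Z.α j‖ ^ D * Real.exp (D * hgtK Z j)) = ∑ j ∈ Z.orb i₀, Real.log (‖eval (Z.α j)
            (map (Int.castRingHom ℂ) Pz)‖ / ‖Z.α j‖ ^ D) + D * ∑ j ∈ Z.orb i₀, hgtK Z j := by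
        rw [Finset.mul_sum, ← Finset.sum_add_distrib]
        refine Finset.sum_congr rfl fun j hj => ?_
        rw [Real.log_mul (hpos j hj).ne' (Real.exp_pos _).ne', Real.log_exp]
      rw [h2]
      linarith
    linarith
  obtain ⟨j₁, hj₁, hz⟩ := hex
  intro j hj
  -- `j` is a conjugate of `j₁`
  rw [← Z.orb_eq_of_mem hj₁] at hj
  obtain ⟨-, g, rfl⟩ := mem_filter.mp hj
  exact eval_perm_eq_zero_of_eval_eq_zero Z Pz hz g

end Roy2013

end Literature.NumberTheory.Transcendental
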